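/-
Copyright (c) 2026 the pub-hodgecm-mathlib formalisation cell (harness21).  Prover seat hodgecm-mathlib-K2Liu-p08 (g6), Track B «K2-LIT»,
#184♮ = hLiu418 = `stmt-HodgeConjecture-24832`; #42S BLOCK D, row D-2, (σ-A) mini-road ((an-3c) §3b, piece (D)-pre 2): RESCALING THE CONE SLOT —
the unit `λ` of the graph reading (position slot `λ • x₁`, SPEC (B2-coord) FILE B) is absorbed into the cone measure and the ζ-Haar measure, so that
★ p864562's letters (L1)(L2) hold verbatim.  THEOREMS ONLY (no `def`, no `instance`, no `notation`, no named-fact hypothesis, no `sorry`, default heartbeats).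
-/
import Literature.NumberTheory.Weil1964.LocalLinearChangeOfVariables        -- ★ `integral_comp_linearEquiv`
import Literature.NumberTheory.Automorphic.LocalPiSchwartzBruhatFourier      -- ★ `piPrimePowBall`, `mem_piPrimePowBall_iff`
import Literature.NumberTheory.Automorphic.AddCharConductorExponent          -- ★ `mul_mem_primePowBall_iff`, `exists_normAbs_eq_inv_zpow`
import Literature.NumberTheory.Automorphic.LocalSchwartzBruhatDirectSum      -- ★ `glue`
import Literature.NumberTheory.Automorphic.TateLocalZetaShells              -- ★ `secondCountableTopology_localField`
import Literature.NumberTheory.Automorphic.SchwartzPiHomothety              -- ★ `smul_mem_piPrimePowBall_iff`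
import HarnessLib

/-!
# Crux `HLiu418`, #42S BLOCK D, row D-2, (σ-A) brick (an-3c) §3b, piece (D)-pre 2: RESCALING THE CONE SLOT BY A UNIT
# — `ν ↦ (λ•)_* ν` keeps the four null-cone clauses, `∫ g(λ•ζ) dμ^κ = |λ|^{-card κ} ∫ g dμ^κ`, and the letters (L1)(L2) re-letter to the SAME slot

Cell `hodgecm-mathlib`, crux item hLiu418 = `stmt-HodgeConjecture-24832`; squad K2 ∕ K2Liu; prover K2Liu-p08 (g6).  Lane `--supports stmt-HodgeConjecture-24832
--as helper` (count-neutral helper; closes no socket).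

WHY.  ★ p864562 `coneWord_of_stageLetters` wants (L2) as `N₁ x ζ = c_F · ∫ V_x((Z_s ζ) ⊔ s) dσ(s)` — the SAME `s` in the graph slot and in the position slot —
while the graph reading of the Levi prefix `m₁·φ(w₁)·φ(u_−(ζ))` ((B), K2Liu-p09 ∕ (B2-coord) SPEC) lands at `(Z_{x₁} ζ′) ⊔ (λ • x₁)` with a FIXED unit `λ ∈ L⁺_v^×`
(the `(i₁,i₀)` entry of `blkD(m₁)⁻¹`).  THIS FILE absorbs `λ` once and for all, generically over a non-archimedean local field `F`:
* §1 `preimage_smul_piPrimePowBall` — `(λ•)⁻¹(𝔭^N)^ι = (𝔭^{N−k})^ι` for `|λ| = q^{−k}` (★ `smul_mem_piPrimePowBall_iff`);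
* §2 **`map_smul_cone_clauses`** — for `ν″ := (λ•)_* ν`: finite on compacts, `ν″{0} = 0`, `ν″{Q ≠ 0} = 0` (`Q(λ⁻¹S) = λ⁻²Q(S)`), and the vertex law
  `ν″((𝔭^{n+1})^ι) = c·ν″((𝔭^n)^ι)` (the law is shift-invariant) — i.e. `ν″` carries ★ p864508 (an-1) B's clauses (2)(3)(4) whenever `ν` does;
* §3 `integral_comp_smul_pi` — `∫ g(λ • ζ) dμ^κ(ζ) = (|λ|^{card κ})⁻¹ · ∫ g dμ^κ` (★ `integral_comp_linearEquiv` at `λ • 1`, `det = λ^{card κ}`);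
* §4 **`stageLetters_rescale`** — from (L1) `N₂val x = c_E·∫ N₁ x ζ′ dμ^κ` and the λ-READING (L2′) `N₁ x ζ′ = c_F·∫ V_x((Z_s ζ′) ⊔ (λ•s)) dν(s)` and the
  bilinearity `Z_{a•s} ζ = Z_s (a•ζ)`: (L1″) `N₂val x = (c_E·|λ|^{card κ})·∫ N₁ x (λ•ζ″) dμ^κ(ζ″)` and (L2″) `N₁ x (λ•ζ″) = c_F·∫ V_x((Z_S ζ″) ⊔ S) dν″(S)` —
  ★ p864562's (L1)(L2) VERBATIM with `σ := ν″`, `N₁ := (x, ζ″) ↦ N₁ x (λ•ζ″)`, `cE := c_E·|λ|^{card κ}`.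
HONEST LABEL.  `HC_CM` is proved only modulo the 7 printed citations (2 remaining named inputs: hLiu418 = `stmt-HodgeConjecture-24832`,
h413 = `stmt-HodgeConjecture-24833`) until rung 0 closes; count-neutral helper, closes no socket.

## References
* [WeilBNT1967] A. Weil, *Basic Number Theory* (1967), Chap. I §2, Th. 3 Cor. 3 (the module of `x ↦ λx` on `F^ι` is `|λ|^ι`); Chap. II §2 Def. 2.
* [KudlaRallis1994] S. Kudla, S. Rallis, Ann. of Math. 140 (1994), §2 (2.10)–(2.12), §5 (5.3)–(5.6).
-/

set_option autoImplicit false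
set_option linter.dupNamespace false -- the mandated namespace repeats `HodgeConjecture.HodgeConjecture`

noncomputable section

open MeasureTheory Set Filter
open scoped NNReal ENNReal
open Literature.NumberTheory.Automorphic
open Literature.NumberTheory.GaloisRepresentations Literature.NumberTheory.GaloisRepresentations.IsNonarchimedeanLocalField
open Literature.NumberTheory.Weil1964

namespace Summit.HodgeConjecture.HodgeConjecture.Cruxes.HLiu418.K2LiuConeSlotRescaling

variable {F : Type*} [Field F] [ValuativeRel F] [TopologicalSpace F] [IsNonarchimedeanLocalField F]
  {ι : Type*}

/-! ## §1 Scaling a box -/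

/-- the preimage of a box under `x ↦ λ • x` is the box shifted by the exponent of `λ` (★ `smul_mem_piPrimePowBall_iff`).
[cite: WeilBNT1967, Chap. II §2, Def. 2] -/
theorem preimage_smul_piPrimePowBall {a : F} {k : ℤ} (ha : normAbs F a = (residueFieldCard F : ℝ≥0)⁻¹ ^ k) (N : ℤ) :
    (fun x : ι → F => a • x) ⁻¹' piPrimePowBall F ι N = piPrimePowBall F ι (N - k) :=
  Set.ext fun _ => smul_mem_piPrimePowBall_iff ha

/-! ## §2 The scaled cone measure keeps the four null-cone clauses -/

section Cone

variable [MeasurableSpace F] [BorelSpace F] [Fintype ι]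

/-- **THE SCALED CONE MEASURE.**  For a unit `λ ≠ 0` and a measure `ν` on `F^ι` carrying ★ p864508 (an-1) B's clauses — finite on compacts, `ν{0} = 0`,
`ν{Q ≠ 0} = 0` for a quadratic form `Q`, and the vertex law `ν((𝔭^{n+1})^ι) = c·ν((𝔭^n)^ι)` for all `n` — the push-forward `ν″ := (λ•)_* ν` carries the same
four clauses (with the same `Q` and the same constant `c`): `λ•` is a homeomorphism fixing `0`, `Q(λ•s) = λ²Q(s)`, and `(λ•)⁻¹((𝔭^n)^ι) = (𝔭^{n−k})^ι` with the
law shift-invariant. [cite: WeilBNT1967, Chap. I §2, Th. 3 Cor. 3] [cite: KudlaRallis1994, §5 (5.3)–(5.6)] -/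
theorem map_smul_cone_clauses (ν : Measure (ι → F)) [IsFiniteMeasureOnCompacts ν] {a : F} (ha0 : a ≠ 0)
    (hν0 : ν {0} = 0) (Q : QuadraticForm F (ι → F)) (hνQ : ν {s | Q s ≠ 0} = 0)
    (c : ℝ) (hlaw : ∀ n : ℤ, ν.real (piPrimePowBall F ι (n + 1)) = c * ν.real (piPrimePowBall F ι n)) :
    IsFiniteMeasureOnCompacts (Measure.map (fun s : ι → F => a • s) ν) ∧
    (Measure.map (fun s : ι → F => a • s) ν) {0} = 0 ∧
    (Measure.map (fun s : ι → F => a • s) ν) {s | Q s ≠ 0} = 0 ∧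
    ∀ n : ℤ, (Measure.map (fun s : ι → F => a • s) ν).real (piPrimePowBall F ι (n + 1)) =
      c * (Measure.map (fun s : ι → F => a • s) ν).real (piPrimePowBall F ι n) := by
  haveI : SecondCountableTopology F := secondCountableTopology_localField F
  have he : (fun s : ι → F => a • s) = ⇑(MeasurableEquiv.smul₀ a ha0 : (ι → F) ≃ᵐ (ι → F)) := rfl
  have happly : ∀ S : Set (ι → F), (Measure.map (fun s : ι → F => a • s) ν) S = ν ((fun s : ι → F => a • s) ⁻¹' S) := fun S => by
    rw [he, MeasurableEquiv.map_apply]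
  obtain ⟨k, hk⟩ := exists_normAbs_eq_inv_zpow ha0
  refine ⟨?_, ?_, ?_, fun n => ?_⟩
  · exact Measure.IsFiniteMeasureOnCompacts.map ν (Homeomorph.smulOfNeZero a ha0)
  · rw [happly]
    have hpre : (fun s : ι → F => a • s) ⁻¹' ({0} : Set (ι → F)) = {0} := by
      ext s
      simp only [mem_preimage, mem_singleton_iff, smul_eq_zero, ha0, false_or]
    rw [hpre, hν0]
  · rw [happly]
    have hpre : (fun s : ι → F => a • s) ⁻¹' {s : ι → F | Q s ≠ 0} = {s | Q s ≠ 0} := by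
      ext s
      simp only [mem_preimage, mem_setOf_eq, QuadraticMap.map_smul, smul_eq_mul, ne_eq, mul_eq_zero, ha0, false_or]
    rw [hpre, hνQ]
  · simp only [measureReal_def, happly, preimage_smul_piPrimePowBall hk]
    have h := hlaw (n - k)
    simp only [measureReal_def] at h
    rw [show n + 1 - k = n - k + 1 by ring, h]

end Cone

/-! ## §3 The module of `ζ ↦ λ • ζ` on `F^κ` -/

section Module

variable [MeasurableSpace F] [BorelSpace F] (μ : Measure F) [μ.IsAddHaarMeasure] {κ : Type*} [Fintype κ]
  {G : Type*} [NormedAddCommGroup G] [NormedSpace ℝ G]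

/-- **`∫ g(λ • ζ) dμ^κ(ζ) = (|λ|^{card κ})⁻¹ · ∫ g dμ^κ`** for `λ ≠ 0` (★ `integral_comp_linearEquiv` at the dilation `λ • 1`, `det(λ • 1) = λ^{card κ}`).
[cite: WeilBNT1967, Chap. I §2, Th. 3 Cor. 3] -/
theorem integral_comp_smul_pi {a : F} (ha0 : a ≠ 0) (g : (κ → F) → G) :
    ∫ ζ, g (a • ζ) ∂(Measure.pi fun _ : κ => μ) =
      (((normAbs F a ^ Fintype.card κ)⁻¹ : ℝ≥0) : ℝ) • ∫ ζ, g ζ ∂(Measure.pi fun _ : κ => μ) := by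
  have h := integral_comp_linearEquiv μ (LinearEquiv.smulOfNeZero F (κ → F) a ha0) g
  have hdet : LinearMap.det ((LinearEquiv.smulOfNeZero F (κ → F) a ha0 : (κ → F) ≃ₗ[F] (κ → F)) : (κ → F) →ₗ[F] (κ → F)) =
      a ^ Fintype.card κ := by
    have hcoe : ((LinearEquiv.smulOfNeZero F (κ → F) a ha0 : (κ → F) ≃ₗ[F] (κ → F)) : (κ → F) →ₗ[F] (κ → F)) =
        a • (LinearMap.id : (κ → F) →ₗ[F] (κ → F)) := by
      apply LinearMap.ext
      intro x
      rfl
    rw [hcoe, LinearMap.det_smul, LinearMap.det_id, mul_one, Module.finrank_fintype_fun_eq_card]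
  rw [hdet, map_inv₀, map_pow] at h
  exact h

end Module

/-! ## §4 Re-lettering (L1)(L2) to the same slot -/

section Letters

variable [MeasurableSpace F] [BorelSpace F] (μ : Measure F) [μ.IsAddHaarMeasure]
  {κ ι₁ ι₁' ιt : Type*} [Fintype κ] (e : ι₁ ⊕ ι₁' ≃ ιt)

/-- **RE-LETTERING (L1)(L2) TO THE SAME SLOT.**  If (L1) `N₂val x = c_E·∫ N₁ x ζ′ dμ^κ(ζ′)`, the λ-reading (L2′)
`N₁ x ζ′ = c_F·∫ V_x((Z_s ζ′) ⊔ (λ • s)) dν(s)` for all `ζ′`, `λ ≠ 0`, and the graph is bilinear in the sense `Z_{a•s} ζ = Z_s (a•ζ)`, then with the scaled slot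
`S := λ•s` (`ν″ := (λ•)_* ν`) and the scaled parameter `ζ′ = λ•ζ″`:
(L1″) `N₂val x = (c_E·|λ|^{card κ}) · ∫ N₁ x (λ•ζ″) dμ^κ(ζ″)` and (L2″) `N₁ x (λ•ζ″) = c_F · ∫ V_x((Z_S ζ″) ⊔ S) dν″(S)` — ★ p864562's letters (L1)(L2) VERBATIM for
`σ := ν″`, `N₁ := (x, ζ″) ↦ N₁ x (λ•ζ″)`. [cite: WeilBNT1967, Chap. I §2, Th. 3 Cor. 3] [cite: KudlaRallis1994, §2 (2.10)–(2.12)] -/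
theorem stageLetters_rescale (Zm : (ι₁' → F) → ((κ → F) →ₗ[F] (ι₁ → F)))
    (hZbil : ∀ (a : F) (s : ι₁' → F) (ζ : κ → F), Zm (a • s) ζ = Zm s (a • ζ))
    {a : F} (ha0 : a ≠ 0) (ν : Measure (ι₁' → F)) (x : F)
    (N₂val : F → ℂ) (N₁ : F → (κ → F) → ℂ) (V : F → (ιt → F) → ℂ) (cE cF : ℂ)
    (hL1 : N₂val x = cE * ∫ ζ, N₁ x ζ ∂(Measure.pi fun _ : κ => μ))
    (hL2 : ∀ ζ : κ → F, N₁ x ζ = cF * ∫ s, V x (glue e (Zm s ζ) (a • s)) ∂ν) :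
    N₂val x = (cE * ((normAbs F a ^ Fintype.card κ : ℝ≥0) : ℝ)) * ∫ ζ, N₁ x (a • ζ) ∂(Measure.pi fun _ : κ => μ) ∧
    ∀ ζ : κ → F, N₁ x (a • ζ) = cF * ∫ S, V x (glue e (Zm S ζ) S) ∂(Measure.map (fun s : ι₁' → F => a • s) ν) := by
  refine ⟨?_, fun ζ => ?_⟩
  · -- (L1″): the module of `ζ ↦ λ • ζ`
    have hmod := integral_comp_smul_pi μ ha0 (N₁ x)
    have hq : (normAbs F a ^ Fintype.card κ : ℝ≥0) ≠ 0 := pow_ne_zero _ (by simpa using ha0)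
    have hq' : ((normAbs F a ^ Fintype.card κ : ℝ≥0) : ℝ) ≠ 0 := by exact_mod_cast hq
    rw [hL1, hmod, NNReal.coe_inv, Complex.real_smul, Complex.ofReal_inv, ← mul_assoc, mul_assoc cE,
      mul_inv_cancel₀ (by exact_mod_cast hq'), mul_one]
  · -- (L2″): push `ν` forward along `λ•` and use bilinearity
    have he : (fun s : ι₁' → F => a • s) = ⇑(MeasurableEquiv.smul₀ a ha0 : (ι₁' → F) ≃ᵐ (ι₁' → F)) := rfl
    rw [he, integral_map_equiv, hL2 (a • ζ)]
    congr 1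
    refine integral_congr_ae (Eventually.of_forall fun s => ?_)
    simp only [MeasurableEquiv.coe_smul₀, hZbil]

end Letters

end Summit.HodgeConjecture.HodgeConjecture.Cruxes.HLiu418.K2LiuConeSlotRescaling

end
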